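import Summits.MatrixMultiplication.OmegaCensus.DominoZ5Z5Consist14x22Table
import HarnessLib

/-!
# Cell `(1,14,22)@925` over `ℤ_5²`, moment-consistency route: row verdicts A (1 of 3)

ω-census `pub-omega`, family (b3), seat pub-omega-group gen 27.  Framing: lottery ticket; floor = certified bounds/negative
ranges.  VALUE: kernel instance data of the moment-consistency route (`DominoZpZpConsist*.lean`, G5 of
`HOME/pub-omega-group-g26/FAMILY-B-ADDENDUM-g26.md`) for the census cell `(1,14,22)@925` (`A ↠ ℤ_5 × ℤ_5`, `|A| = 925 = 5·185`);
NOT progress on ω.  Generated by `HOME/pub-omega-group-g27/code/gen_cell.py` from the exact line census of gen 26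
(`table_p5_d14_e22.json`, engines E1 = E2), every certificate re-verified by independent integer arithmetic before emission.

Row verdicts `rowDead 5 4 Lst L0 T₀ = true` (`Lst = expandLst 5 (lstOfTable tabZ5d14)`, `L0 = l0Z5d14`) for the row chunks
rZ5d14_1, rZ5d14_2, rZ5d14_3 — each a kernel `decide` over 8 pivot pairs `T₀` × 65 pairs `T₁` (orders 2..4).
-/

namespace Summit.MatrixMultiplication.OmegaCensus

open ZpZpDomino

namespace ZpZpDomino

set_option maxRecDepth 100000 in
set_option maxHeartbeats 4000000 in
/-- Row verdicts of chunk `rZ5d14_1`: every pair with first component in it is DEAD (kernel `decide`). [folklore] -/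
theorem rows_rZ5d14_1 : rZ5d14_1.all (rowDead 5 4 (expandLst 5 (lstOfTable tabZ5d14)) l0Z5d14) = true := by
  decide +kernel

set_option maxRecDepth 100000 in
set_option maxHeartbeats 4000000 in
/-- Row verdicts of chunk `rZ5d14_2`: every pair with first component in it is DEAD (kernel `decide`). [folklore] -/
theorem rows_rZ5d14_2 : rZ5d14_2.all (rowDead 5 4 (expandLst 5 (lstOfTable tabZ5d14)) l0Z5d14) = true := by
  decide +kernel

set_option maxRecDepth 100000 in
set_option maxHeartbeats 4000000 in
/-- Row verdicts of chunk `rZ5d14_3`: every pair with first component in it is DEAD (kernel `decide`). [folklore] -/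
theorem rows_rZ5d14_3 : rZ5d14_3.all (rowDead 5 4 (expandLst 5 (lstOfTable tabZ5d14)) l0Z5d14) = true := by
  decide +kernel


end ZpZpDomino

end Summit.MatrixMultiplication.OmegaCensus
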